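import Mathlib
import Summits.KontsevichZagierPeriods.Zeta5Search.CasoratianClassBoundProof
import Summits.KontsevichZagierPeriods.Zeta5Search.ClassExpBoundProof
import Summits.KontsevichZagierPeriods.Zeta5Search.RecordCellAAtlasNotMin
import HarnessLib

/-!
# ζ(5) search — DOMINANCE BY COUNTING: `refund − N_p ≤ LB(b,p)` for every small prime `35p ≤ 3b₀ + 2d + 23`, hence (CV) there

Cell `pub-zeta5` (HONEST FRAMING: systematic search; no irrationality claim unless certified), typer seat
generation 9.  Gen-2 g8's counting argument for the small-prime half of `RecordRayDominance` (REPORT-gen2-g8 §3.7: "for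
`θ ≤ 173/35` point counting gives slack `≥ 173/θ − 35 ≥ 0`"), carried out for an ARBITRARY polytope vector:

* `classExp_ge_count`: `E_x ≥ L(b,p) := ⌊b₀/p⌋ − Σ_j (⌊(b₀ − 2b_j)/p⌋ + 1)` for every class (`#class ≥ ⌊b₀/p⌋`, and a block of
  length `λ_j` holds at most `⌊λ_j/p⌋ + 1` points of one class);
* `casLB_ge_or_noPole`: `LB(b,p) ≥ L + min(0, 3 + L)`, unless no class has a pole (then `LB = 0`);
* **`dominance_of_small_prime`**: `35p ≤ 3b₀ + 2d(b) + 23 → refund b p − pairFloors b p ≤ casLB b p`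
  (`p·N_p ≥ 3(b₀ + 2d) − 21(p−1)`, `p·L ≥ −2d − 8p + 1`);
* with THEOREM LB (`casoratianClassBound_holds`, typer g8): **`casoratianLaw_of_small_prime`** — (CV) at every window prime in that
  range — and on the record ray (`3b₀ + 2d = 173n`): **`recordRayDominance_small`** (`35p ≤ 173n + 23`) and **`recordRayCV_small`**,
  for ALL `n`.  The face-enumeration half `173n/35 < p ≤ 41n` of `RecordRayDominance` remains open in the tree.
Integer bookkeeping and tree theorems; nothing about irrationality.
-/

noncomputable section

open Finset

namespace Summit.KontsevichZagierPeriods.Zeta5Search.ClusterValuation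

open Summit.KontsevichZagierPeriods.Zeta5Search.DualSeries (InBox)
open Summit.KontsevichZagierPeriods.Zeta5Search.WedgeDictionary (dOf)
open Summit.KontsevichZagierPeriods.Zeta5Search.CasoratianValuation (InPolytope pairFloors refund shift casoratian)

/-! ### Counting bound for the class exponent -/

/-- A class contains at least `⌊b₀/p⌋` points (`x < p`). -/
theorem card_classSet_ge (b : ℕ → ℤ) {p x : ℕ} (hp : 0 < p) (hx : x < p) :
    (b 0).toNat / p ≤ (classSet b p x).card := by
  have hmaps : Set.MapsTo (fun k => x + k * p) ↑(range ((b 0).toNat / p)) ↑(classSet b p x) := by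
    intro k hk
    have hk' := mem_range.1 (Finset.mem_coe.1 hk)
    refine Finset.mem_coe.2 (mem_filter.2 ⟨mem_range.2 ?_, by simp [Nat.add_mul_mod_self_right]⟩)
    have h1 : (k + 1) * p ≤ (b 0).toNat / p * p := Nat.mul_le_mul_right _ hk'
    have h2 : (b 0).toNat / p * p ≤ (b 0).toNat := Nat.div_mul_le_self _ _
    nlinarith
  have hinj : Set.InjOn (fun k => x + k * p) ↑(range ((b 0).toNat / p)) := by
    intro k₁ _ k₂ _ h
    simp only at h
    exact Nat.eq_of_mul_eq_mul_right hp (by omega)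
  have := card_le_card_of_injOn _ hmaps hinj
  rwa [card_range] at this

/-- A block holds at most `⌊λ_j/p⌋ + 1` points of one class (`λ_j = b₀ − 2b_j`). -/
theorem nB_le_count (b : ℕ → ℤ) (hb : InPolytope b) {p x : ℕ} (hp : 0 < p) {j : ℕ} (hj : j < 7) :
    (nB b p x j : ℤ) ≤ (b 0 - 2 * b (j + 1)) / (p : ℤ) + 1 := by
  have hβ : 0 ≤ b (j + 1) := (hb.1.2 j (mem_range.2 hj)).1
  have h2β : 2 * b (j + 1) ≤ b 0 := hb.2.1 j (mem_range.2 hj)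
  rcases Nat.eq_zero_or_pos (nB b p x j) with h0 | hpos
  · rw [h0]; push_cast
    have : 0 ≤ (b 0 - 2 * b (j + 1)) / (p : ℤ) := Int.ediv_nonneg (by linarith) (by positivity)
    linarith
  · set S := (classSet b p x).filter fun s => s ∈ blk b j with hS
    have hne : S.Nonempty := card_pos.1 (by rw [hS]; exact hpos)
    have hspan := card_mul_le_span b hp S (filter_subset _ _) hne
    have hM := (mem_blk b j _).1 (mem_filter.1 (S.max'_mem hne)).2
    have hm := (mem_blk b j _).1 (mem_filter.1 (S.min'_mem hne)).2
    have e0 : (((b 0).toNat : ℕ) : ℤ) = b 0 := Int.toNat_of_nonneg hb.1.1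
    have e1 : (((b (j + 1)).toNat : ℕ) : ℤ) = b (j + 1) := Int.toNat_of_nonneg hβ
    have hdiff : (S.max' hne : ℤ) - (S.min' hne : ℤ) ≤ b 0 - 2 * b (j + 1) := by omega
    have hcard : (nB b p x j : ℤ) = S.card := by rw [hS, nB]
    rw [hcard]
    have h1 : (p : ℤ) * ((S.card : ℤ) - 1) ≤ b 0 - 2 * b (j + 1) := hspan.trans hdiff
    have hle : (S.card : ℤ) - 1 ≤ (b 0 - 2 * b (j + 1)) / (p : ℤ) :=
      Int.le_ediv_of_mul_le (by exact_mod_cast hp) (by linarith [mul_comm (p : ℤ) ((S.card : ℤ) - 1)])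
    linarith

/-- **Counting bound**: `E_x ≥ ⌊b₀/p⌋ − Σ_j (⌊(b₀ − 2b_j)/p⌋ + 1)` for every class. -/
theorem classExp_ge_count (b : ℕ → ℤ) (hb : InPolytope b) {p x : ℕ} (hp : 0 < p) (hx : x < p) :
    b 0 / (p : ℤ) - ∑ j ∈ range 7, ((b 0 - 2 * b (j + 1)) / (p : ℤ) + 1) ≤ classExp b p x := by
  have h1 := classExp_ge_card_sub b p x
  have h2 : b 0 / (p : ℤ) ≤ ((classSet b p x).card : ℤ) := by
    have := card_classSet_ge b hp hx
    have e0 : (((b 0).toNat : ℕ) : ℤ) = b 0 := Int.toNat_of_nonneg hb.1.1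
    have : (((b 0).toNat / p : ℕ) : ℤ) ≤ (classSet b p x).card := by exact_mod_cast this
    rw [Int.natCast_div, e0] at this
    exact this
  have h3 : ∑ j ∈ range 7, (nB b p x j : ℤ) ≤ ∑ j ∈ range 7, ((b 0 - 2 * b (j + 1)) / (p : ℤ) + 1) :=
    sum_le_sum fun j hj => nB_le_count b hb hp (mem_range.1 hj)
  linarith

/-- The counting bound times `p`: `p·L ≥ −2d − 8p + 1`. -/
theorem mul_countBound_ge (b : ℕ → ℤ) {p : ℕ} (hp : 0 < p) :
    -2 * dOf b - 8 * p + 1 ≤ (p : ℤ) * (b 0 / (p : ℤ) - ∑ j ∈ range 7, ((b 0 - 2 * b (j + 1)) / (p : ℤ) + 1)) := by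
  have hpZ : (0 : ℤ) < p := by exact_mod_cast hp
  have h0 : b 0 - p + 1 ≤ (p : ℤ) * (b 0 / (p : ℤ)) := by
    have := Int.lt_mul_ediv_self_add (x := b 0) hpZ; linarith
  have hj : ∀ j ∈ range 7, (p : ℤ) * ((b 0 - 2 * b (j + 1)) / (p : ℤ) + 1) ≤ (b 0 - 2 * b (j + 1)) + p := by
    intro j _
    have := Int.mul_ediv_self_le (x := b 0 - 2 * b (j + 1)) hpZ.ne'
    linarith
  have hsum : (p : ℤ) * ∑ j ∈ range 7, ((b 0 - 2 * b (j + 1)) / (p : ℤ) + 1) ≤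
      ∑ j ∈ range 7, ((b 0 - 2 * b (j + 1)) + (p : ℤ)) := by
    rw [mul_sum]; exact sum_le_sum hj
  have hlam : ∑ j ∈ range 7, ((b 0 - 2 * b (j + 1)) + (p : ℤ)) = b 0 + 2 * dOf b + 7 * p := by
    unfold dOf; simp only [sum_range_succ, sum_range_zero]; ring
  rw [mul_sub]
  linarith

/-- The pair floors times `p`: `p·N_p ≥ 3(b₀ + 2d) − 21(p − 1)`. -/
theorem mul_pairFloors_ge (b : ℕ → ℤ) {p : ℕ} (hp : 0 < p) :
    3 * (b 0 + 2 * dOf b) - 21 * (p - 1) ≤ (p : ℤ) * pairFloors b p := by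
  have hpZ : (0 : ℤ) < p := by exact_mod_cast hp
  have hterm : ∀ i ∈ range 7, ∀ k ∈ range 7,
      (if i < k then (b 0 - b (i + 1) - b (k + 1)) - (p - 1) else 0) ≤
        (p : ℤ) * (if i < k then (b 0 - b (i + 1) - b (k + 1)) / (p : ℤ) else 0) := by
    intro i _ k _
    split_ifs
    · have := Int.lt_mul_ediv_self_add (x := b 0 - b (i + 1) - b (k + 1)) hpZ; linarith
    · simp
  have hsum := sum_le_sum fun i hi => sum_le_sum fun k hk => hterm i hi k hk
  have hR : ∑ i ∈ range 7, ∑ k ∈ range 7, (p : ℤ) * (if i < k then (b 0 - b (i + 1) - b (k + 1)) / (p : ℤ) else 0) =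
      (p : ℤ) * pairFloors b p := by
    unfold pairFloors; rw [mul_sum]; exact sum_congr rfl fun i _ => by rw [mul_sum]
  have hL : ∑ i ∈ range 7, ∑ k ∈ range 7, (if i < k then (b 0 - b (i + 1) - b (k + 1)) - ((p : ℤ) - 1) else 0) =
      3 * (b 0 + 2 * dOf b) - 21 * (p - 1) := by
    unfold dOf
    simp only [sum_range_succ, sum_range_zero]
    norm_num
    ring
  linarith

/-! ### Lower bound for `LB(b,p)` -/

/-- **`LB(b,p) ≥ A + B`** whenever `A ≤ ν_x` for every pole class and `B` is below every row (`B ≤ 1`, `B ≤ 3 + E_x` for multipole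
classes, `B ≤ 0` if `p > d`) — unless no class has a pole, in which case `LB = 0`. -/
theorem casLB_ge_or_noPole (b : ℕ → ℤ) (p : ℕ) (A B : ℤ)
    (hA : ∀ x, x < p → 1 ≤ classPoleCount b p x → A ≤ classNu b p x) (hB1 : B ≤ 1)
    (hB2 : ∀ x, x < p → 2 ≤ classPoleCount b p x → B ≤ 3 + classExp b p x) (hB0 : dOf b < (p : ℤ) → B ≤ 0) :
    (casLB b p = 0 ∧ ∀ x, x < p → classPoleCount b p x = 0) ∨ A + B ≤ casLB b p := by
  by_cases hex : ∃ x, x < p ∧ 1 ≤ classPoleCount b p x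
  · obtain ⟨x, hx, hpole⟩ := hex
    obtain ⟨v, hv⟩ := vbMin_isSome b hx hpole
    obtain ⟨r, hr⟩ := rowMin_isSome b hx hpole
    right
    have hcas : casLB b p = v + r := by unfold casLB; rw [hv, hr]
    -- `v` is some `ν_y`, `r` is some row
    have hvmem := (List.min?_eq_some_iff.1 hv).1
    obtain ⟨y, hy, hyv⟩ := List.mem_map.1 hvmem
    obtain ⟨hyp, hypole⟩ := List.mem_filter.1 hy
    have hy' := List.mem_range.1 hyp
    have hAv : A ≤ v := by rw [← hyv]; exact hA y hy' (by simpa using hypole)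
    have hrmem := (List.min?_eq_some_iff.1 hr).1
    have hBr : B ≤ r := by
      rcases List.mem_append.1 hrmem with h | h
      · obtain ⟨z, hz, hzr⟩ := List.mem_filterMap.1 h
        have hz' := List.mem_range.1 hz
        by_cases h1 : classPoleCount b p z = 1
        · rw [if_pos h1] at hzr; have : r = 1 := by simpa using hzr.symm
          rw [this]; exact hB1
        · rw [if_neg h1] at hzr
          by_cases h2 : 2 ≤ classPoleCount b p z
          · rw [if_pos h2] at hzr; have : r = 3 + classExp b p z := by simpa using hzr.symm
            rw [this]; exact hB2 z hz' h2
          · rw [if_neg h2] at hzr; simp at hzr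
      · by_cases hd : dOf b < (p : ℤ)
        · rw [if_pos hd] at h; have : r = 0 := by simpa using h
          rw [this]; exact hB0 hd
        · rw [if_neg hd] at h; simp at h
    rw [hcas]; linarith
  · push Not at hex
    left
    refine ⟨?_, fun x hx => by have := hex x hx; omega⟩
    have hnil : ((List.range p).filter fun y => 1 ≤ classPoleCount b p y) = [] := by
      rw [List.filter_eq_nil_iff]
      intro y hy
      have := hex y (List.mem_range.1 hy)
      simpa using this
    unfold casLB vbMin
    rw [hnil]
    simp

/-! ### Dominance for small primes -/

/-- **DOMINANCE BY COUNTING**: for `35p ≤ 3b₀ + 2d(b) + 23` the class bound dominates the (CV) law. -/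
theorem dominance_of_small_prime (b : ℕ → ℤ) {p : ℕ} (hb : InPolytope b) (hp : 0 < p)
    (hreg : 35 * (p : ℤ) ≤ 3 * b 0 + 2 * dOf b + 23) : refund b p - pairFloors b p ≤ casLB b p := by
  have h0 : 0 ≤ b 0 := hb.1.1
  have hd0 : 0 ≤ dOf b := by have := hb.2.2; unfold dOf; linarith
  have hpZ : (0 : ℤ) < p := by exact_mod_cast hp
  have hr : refund b p ≤ 1 := min_le_left _ _
  have hN := mul_pairFloors_ge b hp
  set L := b 0 / (p : ℤ) - ∑ j ∈ range 7, ((b 0 - 2 * b (j + 1)) / (p : ℤ) + 1) with hL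
  have hLp := mul_countBound_ge b hp
  rw [← hL] at hLp
  rcases casLB_ge_or_noPole b p L (min 0 (3 + L))
      (fun x hx _ => (classExp_ge_count b hb hp hx).trans (CellA.classExp_le_classNu b p x))
      ((min_le_left _ _).trans (by norm_num))
      (fun x hx _ => (min_le_right _ _).trans (by linarith [classExp_ge_count b hb hp hx]))
      (fun _ => min_le_left _ _) with ⟨hzero, -⟩ | hge
  · -- no pole class: `LB = 0 ≥ 1 − N_p`
    rw [hzero]
    have : (p : ℤ) * 1 ≤ (p : ℤ) * pairFloors b p := by nlinarith
    have := le_of_mul_le_mul_left this hpZ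
    linarith
  · rcases le_or_gt (3 + L) 0 with h3 | h3
    · rw [min_eq_right h3] at hge
      -- `2L + 3 ≥ 1 − N_p`
      have : (p : ℤ) * (1 - pairFloors b p) ≤ (p : ℤ) * (2 * L + 3) := by nlinarith
      have := le_of_mul_le_mul_left this hpZ
      linarith
    · rw [min_eq_left (by linarith)] at hge
      -- `L ≥ 1 − N_p`
      have : (p : ℤ) * (1 - pairFloors b p) ≤ (p : ℤ) * L := by nlinarith
      have := le_of_mul_le_mul_left this hpZ
      linarith

/-- **(CV) at every small window prime** (`p² > b₀ + 2`, `35p ≤ 3b₀ + 2d + 23`), by THEOREM LB and the dominance. -/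
theorem casoratianLaw_of_small_prime (b : ℕ → ℤ) {j p : ℕ} (hb : InPolytope b) (hj1 : 1 ≤ j) (hj7 : j ≤ 7)
    (hb' : InPolytope (shift b j)) (hprime : p.Prime) (hp5 : 5 ≤ p) (hwin : (b 0 + 2 : ℤ) < (p : ℤ) ^ 2)
    (hreg : 35 * (p : ℤ) ≤ 3 * b 0 + 2 * dOf b + 23) (hcas : casoratian b j ≠ 0) :
    refund b p - pairFloors b p ≤ padicValRat p (casoratian b j) :=
  (dominance_of_small_prime b hb hprime.pos hreg).trans
    (casoratianClassBound_holds b j p hb hj1 hj7 hb' hprime hp5 hwin hcas)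

/-! ### The record ray below `173n/35` -/

/-- `d(b_rec(n)) = 25n`. -/
theorem dOf_bRec (n : ℕ) : dOf (bRec n) = 25 * n := by
  unfold dOf bRec; simp [sum_range_succ]; ring

/-- **The small-prime half of `RecordRayDominance`, for all `n`**: `35p ≤ 173n + 23 → refund − N_p ≤ LB` on the record ray. -/
theorem recordRayDominance_small (n p : ℕ) (hp : 0 < p) (hreg : 35 * (p : ℤ) ≤ 173 * n + 23) :
    refund (bRec n) p - pairFloors (bRec n) p ≤ casLB (bRec n) p := by
  refine dominance_of_small_prime (bRec n) (inPolytope_bRec n) hp ?_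
  rw [dOf_bRec]; simp [bRec]; linarith

/-- **(CV) ON THE RECORD RAY FOR SMALL PRIMES, ALL `n`**: every prime `5 ≤ p` with `p² > 41n + 2` and `35p ≤ 173n + 23`. -/
theorem recordRayCV_small (n j p : ℕ) (hn : 1 ≤ n) (hj1 : 1 ≤ j) (hj7 : j ≤ 7) (hprime : p.Prime) (hp5 : 5 ≤ p)
    (hreg : 35 * (p : ℤ) ≤ 173 * n + 23) (hwin : (41 * n + 2 : ℤ) < (p : ℤ) ^ 2) (hcas : casoratian (bRec n) j ≠ 0) :
    refund (bRec n) p - pairFloors (bRec n) p ≤ padicValRat p (casoratian (bRec n) j) := by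
  have hwin' : (bRec n 0 + 2 : ℤ) < (p : ℤ) ^ 2 := by simpa [bRec, mul_comm] using hwin
  exact (recordRayDominance_small n p hprime.pos hreg).trans
    (casoratianClassBound_holds (bRec n) j p (inPolytope_bRec n) hj1 hj7 (inPolytope_shift_bRec n j hn hj1 hj7) hprime hp5
      hwin' hcas)

end Summit.KontsevichZagierPeriods.Zeta5Search.ClusterValuation

end
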